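import Mathlib
import HarnessLib
import HarnessLib.Audit
import Summits.AtomisticToContinuum.Crystallization.Statement
import Summits.AtomisticToContinuum.Crystallization.Theses.MinMeanCycleStackingLock
import Summits.AtomisticToContinuum.Crystallization.Theses.LaminarSixThreeThree
import Literature.MathematicalPhysics.StatisticalMechanics.BarlowStacking

/-!
# Crux `BulkDefectVanishBased` (stmt-AtomisticToContinuum-12020) — birth skeleton (BC3)

Route `MinMeanCycleStackingLock`, sub-problem `Crystallization`, crux rank 5 (the polytype-agnostic
positional hinge `X_pos`):

  `∃ P` periodic such that for all `R, ε > 0`, along every sequence of Lennard-Jones ground states,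
  all but `o(N)` particles `i` admit a linear isometry `A` and a base point `p ∈ P.points` with the
  particles of `B_R(x_i)` two-way `ε`-matched to `x_i + A((P.points − p) ∩ B̄_R(p))`.

## The line (two stubs, the cut announced in the route header's two-layer plan
"BulkDefectVanishBased ⇐ GroundStateLayering → StackingFaultCount")

* `stub_laminarBarlowWindows` — LAYERING HALF (shared open physics): for all `R > 0`, `ε ∈ (0, 1/4)`
  and every ground-state sequence, all but `o(N)` particles have their `R`-window two-way
  `ε`-matched (after `x ↦ x_i + A(· − z)`) to SOME Barlow stacking `barlowStacking a h s`,
  `a, h ∈ (1/2, 2)`, `s` any Hägg sequence. This is, VERBATIM, the signature of the existing open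
  item `stmt-AtomisticToContinuum-14292` (`LaminarSixThreeThree.LaminarBarlowWindows`, also wanted by
  `SquareWellLayerCake`), so the stub is discharged by name the day 14292 closes.
* `stub_lockedStackingSelection` — SELECTION HALF (this route's mechanism; new statement
  `LockedStackingSelection`): ONE periodic `P` such that for every target scale `(R, ε)` there is a
  finer/larger certification scale `(R', ε')`, `0 < ε' < 1/4`, at which, along every ground-state
  sequence, the particles that ARE Barlow-matched at `(R', ε')` but are NOT matched to a based window
  of `P` at `(R, ε)` number `o(N)`. Content: (i) parameter selection — a bulk region Barlow-matched
  at parameters `(a, h)` off the optimal `(a*, h*)` by `δ` costs `≳ δ²` per particle (strict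
  stability of the relaxed close-packed lattice energy in `(a, h)`) against the `O(N^{2/3})` surface
  budget; (ii) stacking selection — every `K`-window of the local Hägg word outside the locked
  certificate set `E` costs at least the fault price `g − 2·tail > 0` per unit layer area
  (`LockedPhaseDefectBound`, item 12024, PROVED) against the same budget, so `O(N^{2/3})` faulted
  windows; `P := barlowPeriodicConfiguration w a* h*` for the certificate's `E`-periodic word `w`.
* `BulkDefectVanishBased_of` — the kernel-checked composition (real proof, no sorry):
  `stub₁-signature → stub₂-signature → (body of the crux, verbatim)`: the `(R, ε)`-bad set of the
  crux is contained in `{not Barlow-matched at (R', ε')} ∪ {Barlow-matched at (R', ε') and not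
  P-matched at (R, ε)}`; union bound on `Nat.card` and a squeeze of densities.
* `BulkDefectVanishBased_of_stubs : MinMeanCycleStackingLock.BulkDefectVanishBased` — the crux BY
  NAME from the two stubs fed into `BulkDefectVanishBased_of` (the skeleton theorem of the audit; the
  only `sorry`s in its cone are the two `stub_*`). Same two-theorem layout as the registered
  skeleton `Cruxes/CoerciveVarianceCertificate/Lines/birth.lean`.

`sorry` occurs only inside the two `stub_*` theorems; the closing `example`s certify that the
inlined stub signatures are definitionally the named statements (item 14292's decl
`LaminarSixThreeThree.LaminarBarlowWindows`, and `LockedStackingSelection` below).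

Disproof used: none on file for this crux (`ledger crux ls stmt-AtomisticToContinuum-12020`: no
`Disproof.lean`, 2026-08-17). Negatives 4146 (1%-tolerance local Hales, deterministic 12-shells)
and 3506 (one-grain gluing `∀ P`) are not instances of either stub (both stubs are asymptotic
`o(N)` statements over ground-state sequences with tolerance `∀ ε`).
-/

namespace Summit.AtomisticToContinuum.Crystallization.Cruxes.BulkDefectVanishBased.Birth

open Filter

/-! ## Generic counting glue (proved) -/

/-- Union bound behind the two-stage assembly: a particle that is not `G`-good is either not
`B`-good, or `B`-good and not `G`-good. [folklore] -/
theorem natCard_not_le_add {N : ℕ} (B G : Fin N → Prop) :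
    Nat.card {i : Fin N // ¬ G i} ≤
      Nat.card {i : Fin N // ¬ B i} + Nat.card {i : Fin N // B i ∧ ¬ G i} := by
  calc Nat.card {i : Fin N // ¬ G i} = ({i | ¬ G i} : Set (Fin N)).ncard := rfl
    _ ≤ ({i | ¬ B i} ∪ {i | B i ∧ ¬ G i} : Set (Fin N)).ncard := by
        refine Set.ncard_le_ncard (fun i hi => ?_)
        simp only [Set.mem_setOf_eq, Set.mem_union] at hi ⊢
        by_cases hB : B i
        · exact Or.inr ⟨hB, hi⟩
        · exact Or.inl hB
    _ ≤ ({i | ¬ B i} : Set (Fin N)).ncard + ({i | B i ∧ ¬ G i} : Set (Fin N)).ncard :=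
        Set.ncard_union_le _ _
    _ = Nat.card {i : Fin N // ¬ B i} + Nat.card {i : Fin N // B i ∧ ¬ G i} := rfl

/-- Two-stage density bound: if along `N → ∞` the density of particles that are not `B`-good and
the density of particles that are `B`-good but not `G`-good both tend to `0`, then the density of
particles that are not `G`-good tends to `0`. [folklore] -/
theorem tendsto_density_two_stage (B G : (N : ℕ) → Fin N → Prop)
    (hB : Tendsto (fun N : ℕ => (Nat.card {i : Fin N // ¬ B N i} : ℝ) / N) atTop (nhds 0))
    (hBG : Tendsto (fun N : ℕ => (Nat.card {i : Fin N // B N i ∧ ¬ G N i} : ℝ) / N)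
      atTop (nhds 0)) :
    Tendsto (fun N : ℕ => (Nat.card {i : Fin N // ¬ G N i} : ℝ) / N) atTop (nhds 0) := by
  have hsum : Tendsto (fun N : ℕ => (Nat.card {i : Fin N // ¬ B N i} : ℝ) / N +
      (Nat.card {i : Fin N // B N i ∧ ¬ G N i} : ℝ) / N) atTop (nhds 0) := by
    simpa only [add_zero] using hB.add hBG
  refine squeeze_zero (fun N => by positivity) (fun N => ?_) hsum
  rw [← add_div]
  gcongr
  exact_mod_cast natCard_not_le_add (B N) (G N)

/-! ## The stubs -/

/-- **Stub 1 — layering half (LAMINAR BARLOW WINDOWS).** For all `R > 0`, `ε ∈ (0, 1/4)` and every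
sequence of Lennard-Jones ground states, the fraction of particles `i` whose `R`-window is NOT
two-way `ε`-matched (after `x ↦ x_i + A(· − z)`, `A` a linear isometry, `z` a stacking point) to
`barlowStacking a h s` for some `a, h ∈ (1/2, 2)` and Hägg sequence `s` tends to `0`.
VERBATIM the signature of the open item `stmt-AtomisticToContinuum-14292`
(`Summit.AtomisticToContinuum.Crystallization.Theses.LaminarSixThreeThree.LaminarBarlowWindows`).
Why plausibly true: it is the positional content every sphere-packing-heritage route bets on (soft
twelve-coordination of bulk particles + a local Hales step at tolerance ≤ 1/400, never the refuted
1/100 form 4146). Size: XL (open problem in print, Blanc–Lewin 2015 §2.3). -/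
theorem stub_laminarBarlowWindows : ∀ R ε : ℝ, 0 < R → 0 < ε → ε < 1 / 4 → ∀ x : (N : ℕ) → (Fin N → EuclideanSpace ℝ (Fin 3)), (∀ N, Literature.MathematicalPhysics.StatisticalMechanics.IsGroundState Literature.MathematicalPhysics.StatisticalMechanics.lennardJones (x N)) → Filter.Tendsto (fun N : ℕ => (Nat.card {i : Fin N // ¬ (∃ a h : ℝ, 1 / 2 < a ∧ a < 2 ∧ 1 / 2 < h ∧ h < 2 ∧ ∃ s : ℤ → ℤ, Literature.MathematicalPhysics.StatisticalMechanics.IsHaggSeq s ∧ ∃ z ∈ Literature.MathematicalPhysics.StatisticalMechanics.barlowStacking a h s, ∃ A : EuclideanSpace ℝ (Fin 3) →ₗᵢ[ℝ] EuclideanSpace ℝ (Fin 3), (∀ p ∈ Literature.MathematicalPhysics.StatisticalMechanics.barlowStacking a h s, dist p z ≤ R → ∃ j : Fin N, dist (x N j) (x N i + A (p - z)) ≤ ε) ∧ (∀ j : Fin N, dist (x N j) (x N i) ≤ R → ∃ p ∈ Literature.MathematicalPhysics.StatisticalMechanics.barlowStacking a h s, dist (x N j) (x N i + A (p - z)) ≤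 ε))} : ℝ) / N) Filter.atTop (nhds 0) := by
  sorry

/-- **Statement of stub 2 — selection half (LOCKED STACKING SELECTION, two scales).** There is ONE
periodic configuration `P` of `ℝ³` such that for every window radius `R > 0` and tolerance `ε > 0`
there are a certification radius `R' > 0` and tolerance `ε' ∈ (0, 1/4)` such that, along every
sequence of Lennard-Jones ground states, the fraction of particles `i` whose `R'`-window IS two-way
`ε'`-matched to some Barlow stacking (`a, h ∈ (1/2, 2)`, any Hägg sequence; the predicate of
item 14292 at `(R', ε')`) but whose `R`-window is NOT two-way `ε`-matched to a based window
`x_i + A((P.points − p) ∩ B̄_R(p))`, `p ∈ P.points` (the predicate of the crux at `(R, ε)`), tends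
to `0`. Intended witness: `P = barlowPeriodicConfiguration w a* h*`, `w` the `E`-periodic word of
the Lennard-Jones locking certificate; `R' ≫ R`, `ε' ≪ ε/R`. -/
def LockedStackingSelection : Prop :=
  ∃ P : Literature.MathematicalPhysics.StatisticalMechanics.PeriodicConfiguration 3, ∀ R ε : ℝ, 0 < R → 0 < ε → ∃ R' ε' : ℝ, 0 < R' ∧ 0 < ε' ∧ ε' < 1 / 4 ∧ ∀ x : (N : ℕ) → (Fin N → EuclideanSpace ℝ (Fin 3)), (∀ N, Literature.MathematicalPhysics.StatisticalMechanics.IsGroundState Literature.MathematicalPhysics.StatisticalMechanics.lennardJones (x N)) → Filter.Tendsto (fun N : ℕ => (Nat.card {i : Fin N // (∃ a h : ℝ, 1 / 2 < a ∧ a < 2 ∧ 1 / 2 < h ∧ h < 2 ∧ ∃ s : ℤ → ℤ, Literature.MathematicalPhysics.StatisticalMechanics.IsHaggSeq s ∧ ∃ z ∈ Literature.MathematicalPhysics.StatisticalMechanics.barlowStacking a h s, ∃ A : EuclideanSpace ℝ (Fin 3) →ₗᵢ[ℝ] EuclideanSpace ℝ (Fin 3), (∀ p ∈ Literature.MathematicalPhysics.StatisticalMechanics.barlowStacking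 a h s, dist p z ≤ R' → ∃ j : Fin N, dist (x N j) (x N i + A (p - z)) ≤ ε') ∧ (∀ j : Fin N, dist (x N j) (x N i) ≤ R' → ∃ p ∈ Literature.MathematicalPhysics.StatisticalMechanics.barlowStacking a h s, dist (x N j) (x N i + A (p - z)) ≤ ε')) ∧ ¬ (∃ A : EuclideanSpace ℝ (Fin 3) →ₗᵢ[ℝ] EuclideanSpace ℝ (Fin 3), ∃ p ∈ P.points, (∀ q ∈ P.points, dist q p ≤ R → ∃ j : Fin N, dist (x N j) (x N i + A (q - p)) ≤ ε) ∧ (∀ j : Fin N, dist (x N j) (x N i) ≤ R → ∃ q ∈ P.points, dist (x N j) (x N i + A (q - p)) ≤ ε))} : ℝ) / N) Filter.atTop (nhds 0)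

/-- **Stub 2 — selection half** (the statement `LockedStackingSelection`, inlined verbatim so that
the registered signature is self-contained). Why plausibly true: (i) off-optimal lattice parameters
in a Barlow-matched bulk region cost volume energy `≳ δ²·#region` (strict stability of the relaxed
hcp/fcc lattice sums in `(a, h)`; second-order information available from the certified coupling
box of item 12019) while ground states exceed `N·e_∞` by only `O(N^{2/3})`; (ii) faulted stacking
windows are priced by the PROVED `LockedPhaseDefectBound` (item 12024: `(g − 2·tail)·#{off-E
windows} ≤ H_n − n·e(w) + C`) column by column against the same surface budget, giving `O(N^{2/3})`
faulted `R`-windows. Fails iff LJ ground states carry extensive wrong-parameter or wrong-stacking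
Barlow grains (e.g. degenerate polytypes at the certificate's resolution). Size: L–XL. Leans on:
`LockedPhaseDefectBound` (12024, proved), `LJLockingCertificate` (12019, open computation),
`LennardJonesMinimalDistance_holds`, `BarlowStackingWindowRebase.twoWayMatch_rebase`,
`CrysEnergyLimit_holds` (surface budget side needs the `O(N^{2/3})` upper bound, trial states). -/
theorem stub_lockedStackingSelection : ∃ P : Literature.MathematicalPhysics.StatisticalMechanics.PeriodicConfiguration 3, ∀ R ε : ℝ, 0 < R → 0 < ε → ∃ R' ε' : ℝ, 0 < R' ∧ 0 < ε' ∧ ε' < 1 / 4 ∧ ∀ x : (N : ℕ) → (Fin N → EuclideanSpace ℝ (Fin 3)), (∀ N, Literature.MathematicalPhysics.StatisticalMechanics.IsGroundState Literature.MathematicalPhysics.StatisticalMechanics.lennardJones (x N)) → Filter.Tendsto (fun N : ℕ => (Nat.card {i : Fin N // (∃ a h : ℝ, 1 / 2 < a ∧ a < 2 ∧ 1 / 2 < h ∧ h < 2 ∧ ∃ s : ℤ → ℤ, Literature.MathematicalPhysics.StatisticalMechanics.IsHaggSeq s ∧ ∃ z ∈ Literature.MathematicalPhysics.StatisticalMechanics.barlowStacking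 a h s, ∃ A : EuclideanSpace ℝ (Fin 3) →ₗᵢ[ℝ] EuclideanSpace ℝ (Fin 3), (∀ p ∈ Literature.MathematicalPhysics.StatisticalMechanics.barlowStacking a h s, dist p z ≤ R' → ∃ j : Fin N, dist (x N j) (x N i + A (p - z)) ≤ ε') ∧ (∀ j : Fin N, dist (x N j) (x N i) ≤ R' → ∃ p ∈ Literature.MathematicalPhysics.StatisticalMechanics.barlowStacking a h s, dist (x N j) (x N i + A (p - z)) ≤ ε')) ∧ ¬ (∃ A : EuclideanSpace ℝ (Fin 3) →ₗᵢ[ℝ] EuclideanSpace ℝ (Fin 3), ∃ p ∈ P.points, (∀ q ∈ P.points, dist q p ≤ R → ∃ j : Fin N, dist (x N j) (x N i + A (q - p)) ≤ ε) ∧ (∀ j : Fin N, dist (x N j) (x N i) ≤ R → ∃ q ∈ P.points, dist (x N j) (x N i + A (q - p)) ≤ ε))} : ℝ) / N) Filter.atTop (nhds 0) := by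
  sorry

/-! ## The composition (kernel-checked, no sorry) -/

/-- **Composition** `stub₁-signature → stub₂-signature → (body of the crux, verbatim)`, real
proof: take the `P` of the selection statement; for a target scale `(R, ε)` take its certification
scale `(R', ε')`; the `(R, ε)`-bad particles of the crux are covered by the non-Barlow particles at
`(R', ε')` (density `→ 0` by laminar Barlow windows) and the Barlow-but-not-`P` particles (density
`→ 0` by locked selection): `natCard_not_le_add` + `tendsto_density_two_stage`. The conclusion is
the body of `MinMeanCycleStackingLock.BulkDefectVanishBased` verbatim (definitionally the crux;
`BulkDefectVanishBased_of_stubs` below states it by name). -/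
theorem BulkDefectVanishBased_of : (∀ R ε : ℝ, 0 < R → 0 < ε → ε < 1 / 4 → ∀ x : (N : ℕ) → (Fin N → EuclideanSpace ℝ (Fin 3)), (∀ N, Literature.MathematicalPhysics.StatisticalMechanics.IsGroundState Literature.MathematicalPhysics.StatisticalMechanics.lennardJones (x N)) → Filter.Tendsto (fun N : ℕ => (Nat.card {i : Fin N // ¬ (∃ a h : ℝ, 1 / 2 < a ∧ a < 2 ∧ 1 / 2 < h ∧ h < 2 ∧ ∃ s : ℤ → ℤ, Literature.MathematicalPhysics.StatisticalMechanics.IsHaggSeq s ∧ ∃ z ∈ Literature.MathematicalPhysics.StatisticalMechanics.barlowStacking a h s, ∃ A : EuclideanSpace ℝ (Fin 3) →ₗᵢ[ℝ] EuclideanSpace ℝ (Fin 3), (∀ p ∈ Literature.MathematicalPhysics.StatisticalMechanics.barlowStacking a h s, dist p z ≤ R → ∃ j : Fin N, dist (x N j) (x N i + A (p - z)) ≤ ε) ∧ (∀ j : Fin N, dist (x N j) (x N i) ≤ R → ∃ p ∈ Literature.MathematicalPhysics.StatisticalMechanics.barlowStacking a h s, dist (x N j) (x N i + A (p - z)) ≤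 ε))} : ℝ) / N) Filter.atTop (nhds 0)) → (∃ P : Literature.MathematicalPhysics.StatisticalMechanics.PeriodicConfiguration 3, ∀ R ε : ℝ, 0 < R → 0 < ε → ∃ R' ε' : ℝ, 0 < R' ∧ 0 < ε' ∧ ε' < 1 / 4 ∧ ∀ x : (N : ℕ) → (Fin N → EuclideanSpace ℝ (Fin 3)), (∀ N, Literature.MathematicalPhysics.StatisticalMechanics.IsGroundState Literature.MathematicalPhysics.StatisticalMechanics.lennardJones (x N)) → Filter.Tendsto (fun N : ℕ => (Nat.card {i : Fin N // (∃ a h : ℝ, 1 / 2 < a ∧ a < 2 ∧ 1 / 2 < h ∧ h < 2 ∧ ∃ s : ℤ → ℤ, Literature.MathematicalPhysics.StatisticalMechanics.IsHaggSeq s ∧ ∃ z ∈ Literature.MathematicalPhysics.StatisticalMechanics.barlowStacking a h s, ∃ A : EuclideanSpace ℝ (Fin 3) →ₗᵢ[ℝ] EuclideanSpace ℝ (Fin 3), (∀ p ∈ Literature.MathematicalPhysics.StatisticalMechanics.barlowStacking a h s, dist p z ≤ R' → ∃ j : Fin N, dist (x N j) (x N i + A (p - z)) ≤ ε') ∧ (∀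 j : Fin N, dist (x N j) (x N i) ≤ R' → ∃ p ∈ Literature.MathematicalPhysics.StatisticalMechanics.barlowStacking a h s, dist (x N j) (x N i + A (p - z)) ≤ ε')) ∧ ¬ (∃ A : EuclideanSpace ℝ (Fin 3) →ₗᵢ[ℝ] EuclideanSpace ℝ (Fin 3), ∃ p ∈ P.points, (∀ q ∈ P.points, dist q p ≤ R → ∃ j : Fin N, dist (x N j) (x N i + A (q - p)) ≤ ε) ∧ (∀ j : Fin N, dist (x N j) (x N i) ≤ R → ∃ q ∈ P.points, dist (x N j) (x N i + A (q - p)) ≤ ε))} : ℝ) / N) Filter.atTop (nhds 0)) → ∃ P : Literature.MathematicalPhysics.StatisticalMechanics.PeriodicConfiguration 3, ∀ R ε : ℝ, 0 < R → 0 < ε → ∀ x : (N : ℕ) → (Fin N → EuclideanSpace ℝ (Fin 3)), (∀ N, Literature.MathematicalPhysics.StatisticalMechanics.IsGroundState Literature.MathematicalPhysics.StatisticalMechanics.lennardJones (x N)) → Filter.Tendsto (fun N : ℕ => (Nat.card {i : Fin N // ¬ ∃ A : EuclideanSpace ℝ (Fin 3) →ₗᵢ[ℝ] EuclideanSpace ℝ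 (Fin 3), ∃ p ∈ P.points, (∀ q ∈ P.points, dist q p ≤ R → ∃ j : Fin N, dist (x N j) (x N i + A (q - p)) ≤ ε) ∧ (∀ j : Fin N, dist (x N j) (x N i) ≤ R → ∃ q ∈ P.points, dist (x N j) (x N i + A (q - p)) ≤ ε)} : ℝ) / N) Filter.atTop (nhds 0) := by
  intro hL hS
  obtain ⟨P, hP⟩ := hS
  refine ⟨P, fun R ε hR hε x hx => ?_⟩
  obtain ⟨R', ε', hR', hε', hε'4, hS'⟩ := hP R ε hR hε
  exact tendsto_density_two_stage _ _ (hL R' ε' hR' hε' hε'4 x hx) (hS' x hx)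

/-- **The crux BY NAME from the two stubs** (type literally the route decl; the only `sorry`s in
its cone are `stub_laminarBarlowWindows` and `stub_lockedStackingSelection`). -/
theorem BulkDefectVanishBased_of_stubs :
    Summit.AtomisticToContinuum.Crystallization.Theses.MinMeanCycleStackingLock.BulkDefectVanishBased :=
  BulkDefectVanishBased_of stub_laminarBarlowWindows stub_lockedStackingSelection

/-- By-name reading of the composition: item 14292's decl and the named statement
`LockedStackingSelection` imply the crux decl (certifies that the inlined signatures of
`BulkDefectVanishBased_of` are definitionally these named statements). -/
example : Summit.AtomisticToContinuum.Crystallization.Theses.LaminarSixThreeThree.LaminarBarlowWindows →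
    LockedStackingSelection →
    Summit.AtomisticToContinuum.Crystallization.Theses.MinMeanCycleStackingLock.BulkDefectVanishBased :=
  fun hL hS => BulkDefectVanishBased_of hL hS

/-- The registered stub signatures are, definitionally, item 14292's decl and `LockedStackingSelection`. -/
example : Summit.AtomisticToContinuum.Crystallization.Theses.LaminarSixThreeThree.LaminarBarlowWindows ∧
    LockedStackingSelection :=
  ⟨stub_laminarBarlowWindows, stub_lockedStackingSelection⟩

end Summit.AtomisticToContinuum.Crystallization.Cruxes.BulkDefectVanishBased.Birth
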